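import Literature.NumberTheory.EllipticCurves.TorsionFilAtCyclicMultiplicativeThreeProofs
import Literature.NumberTheory.EllipticCurves.SemistableReductionBaseChange
import Literature.NumberTheory.EllipticCurves.NeronLocalHeightCompletion
import Literature.NumberTheory.EllipticCurves.RootNumberProofs
import Literature.NumberTheory.EllipticCurves.Rank1Residual.Predicates
import HarnessLib

/-!
# The twin's Tate line at the places above `3`: `Fil_w E′_K[3^k]` is cyclic and isotropic for `E′/ℚ` multiplicative at `3`
# and any number field `K` (crux stmt-BirchSwinnertonDyer-24737, line `beta-road`, K2 stub, E2 unit at `w ∣ 3`)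

Helper file (THEOREMS ONLY: no definition, no named fact, no instance, no `sorry`) for crux r205 stmt-BirchSwinnertonDyer-24737
`…Theses.UniversalToricDescent.TwinAlgMuZeroAtThree`, line `beta-road` (skeleton v10 cd44fe9d5c6b9a78), stub `stub_howardOutputsOfFamily`:
the bucket-B hypothesis `Rank1Residual.Mult W′ 3` of the crux, transported to the places `w ∋ 3` of `K` (Silverman AEC VII.5.4(b):
multiplicative reduction is stable under base change, tree `hasMultiplicativeReductionAt_baseChange_of_liesOver`), and the consequences
of `Literature/…/TorsionFilAtCyclicMultiplicativeThreeProofs` for the Tate line `Fil_w E′_K[3^k] = E′[3^k] ∩ E′₁(K̄_w)`: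

* `hasMultiplicativeReductionAt_baseChange_of_mult_three` — `(W′.baseChange K).HasMultiplicativeReductionAt w` for every `w ∋ 3`;
* **`twin_tateLine_cyclic`** — `Fil_w E′_K[3^k]` is cyclic (`∃ P₀, ∀ P, ∃ c : ℤ, P = c • P₀`, the binder shape of x9's
  `exists_generator_torsionFilAt`);
* **`twin_tateLine_isotropic`** — every bi-additive `e` on `E′_K[3^k]` with `e(a, a) = 0` (the Weil pairing) kills `Fil_w × Fil_w` — the
  `E`-level input of the isotropy `hOrth` of Howard's H.4 at `w ∣ 3` for the twin (x9 `eisensteinTower_isSelfOrthogonalAt_of_mem`).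
No `ρ̄`/Heegner/anticyclotomic hypothesis is used here.  BSD is NOT proved by this file; 24737 stays OPEN.

References: J. H. Silverman, AEC (2009), VII.5 Prop. 5.1(b), 5.4(b), III Ex. 3.7 [SilvermanAEC2009]; ATAEC (1994) V.3 [SilvermanATAEC1994];
B. Howard, Compositio Math. 140 (2004), §3.1, Lemma 3.1.1 [Howard2004HeegnerKolyvagin].
-/

set_option autoImplicit false
-- the summit and its single problem are both named `BirchSwinnertonDyer` (registry layout D-0017)
set_option linter.dupNamespace false

noncomputable section

open scoped Classical NumberField
open NumberField IsDedekindDomain IsDedekindDomain.HeightOneSpectrum Rat.HeightOneSpectrum WeierstrassCurve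
open Literature.NumberTheory.EllipticCurves

namespace Summit.BirchSwinnertonDyer.BirchSwinnertonDyer.Theorems.UniversalToricDescentTwinTateLineAtThree

/-- Place bookkeeping: a place `w ∋ p` of a number field lies over the place `v` of `ℤ` with `primesEquiv v = p`.
(Adapted from the tree's private `liesOver_of_natCast_mem` of `SemistabilityDefectDiscriminantBoundProofs`.) [folklore] -/
theorem liesOver_of_natCast_mem {p : ℕ} (v : HeightOneSpectrum ℤ) (hv : ((primesEquiv (R := ℤ) v : Nat.Primes) : ℕ) = p)
    {F : Type} [Field F] [NumberField F] (w : HeightOneSpectrum (𝓞 F)) (hw : (p : 𝓞 F) ∈ w.asIdeal) :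
    w.asIdeal.LiesOver v.asIdeal := by
  have hgen : natGenerator v = p := hv
  have hvspan : v.asIdeal = Ideal.span {(p : ℤ)} := by
    rw [asIdeal_eq_span_natGenerator_int, hgen]
  have hle : v.asIdeal ≤ w.asIdeal.under ℤ := by
    rw [hvspan, Ideal.span_le, Set.singleton_subset_iff, SetLike.mem_coe, Ideal.under_def,
      Ideal.mem_comap, map_natCast]
    exact hw
  exact ⟨((v.isMaximal.eq_of_le (Ideal.IsPrime.ne_top inferInstance) hle).symm).symm⟩

/-- **The twin is multiplicative at every place above `3`.** For `E′/ℚ` multiplicative at `3` (`Rank1Residual.Mult W′ 3`, the bucket-B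
hypothesis of crux 24737) and any number field `K`, `E′_K = W′.baseChange K` has multiplicative reduction at every `w ∋ 3`
(Silverman AEC VII.5.4(b); tree `hasMultiplicativeReductionAt_baseChange_of_liesOver` +
`hasMultiplicativeReductionAtPrime_primesEquiv_iff_hasMultiplicativeReductionAt`). [cite: SilvermanAEC2009, VII.5 Prop. 5.4 (b)] -/
theorem hasMultiplicativeReductionAt_baseChange_of_mult_three (W' : WeierstrassCurve ℚ) [W'.IsElliptic]
    (hm : Rank1Residual.Mult W' 3) (K : Type) [Field K] [NumberField K] (w : HeightOneSpectrum (𝓞 K))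
    (hw : ((3 : ℕ) : 𝓞 K) ∈ w.asIdeal) : (W'.baseChange K).HasMultiplicativeReductionAt w := by
  set v : HeightOneSpectrum ℤ := (primesEquiv (R := ℤ)).symm ⟨3, Nat.prime_three⟩ with hvdef
  have hv : ((primesEquiv (R := ℤ) v : Nat.Primes) : ℕ) = 3 := by rw [hvdef, Equiv.apply_symm_apply]
  have hmultv : W'.HasMultiplicativeReductionAt v := by
    rw [← hasMultiplicativeReductionAtPrime_primesEquiv_iff_hasMultiplicativeReductionAt W' v]
    have hq : primesEquiv (R := ℤ) v = ⟨3, Nat.prime_three⟩ := by rw [hvdef, Equiv.apply_symm_apply]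
    -- transport `Mult W′ 3` along `primesEquiv v = ⟨3, _⟩`
    revert hq
    generalize (primesEquiv (R := ℤ) v) = q
    rintro rfl
    exact hm
  haveI := liesOver_of_natCast_mem v hv w hw
  exact hasMultiplicativeReductionAt_baseChange_of_liesOver K (v := v) (w := w) W' hmultv

variable (W' : WeierstrassCurve ℚ) [W'.IsElliptic] (K : Type) [Field K] [NumberField K] (w : HeightOneSpectrum (𝓞 K))

/-- **The twin's Tate line `Fil_w E′_K[3^k]` is cyclic** at every `w ∋ 3`, for `E′/ℚ` multiplicative at `3` (no très-ramifié, image or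
Heegner hypothesis): `∃ P₀ ∈ Fil_w, ∀ P ∈ Fil_w, ∃ c : ℤ, P = c • P₀` (binder shape of x9's `exists_generator_torsionFilAt`).
[cite: SilvermanATAEC1994, V.3 (Tate curve: E[p^k] ∩ E₁ = μ_{p^k})] [cite: Howard2004HeegnerKolyvagin, §3.1 (Fil_v T has rank one)] -/
theorem twin_tateLine_cyclic (hm : Rank1Residual.Mult W' 3) (hw : ((3 : ℕ) : 𝓞 K) ∈ w.asIdeal) (k : ℕ) :
    ∃ P₀ ∈ (W'.baseChange K).torsionFilAt w (((3 : ℕ) : ℤ) ^ k),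
      ∀ P ∈ (W'.baseChange K).torsionFilAt w (((3 : ℕ) : ℤ) ^ k), ∃ c : ℤ, P = c • P₀ := by
  haveI : (W'.baseChange K).IsElliptic := by rw [WeierstrassCurve.baseChange]; infer_instance
  exact (W'.baseChange K).exists_generator_torsionFilAt_of_hasMultiplicativeReductionAt_three w hw
    (hasMultiplicativeReductionAt_baseChange_of_mult_three W' hm K w hw) k

/-- **The twin's Tate line is isotropic for every alternating bi-additive pairing on `E′_K[3^k]`** (the Weil pairing `e_{3^k}`) at every
`w ∋ 3`: the `E`-level (Iso) input of Howard's H.4 at `w ∣ 3` for the twin. [cite: Howard2004HeegnerKolyvagin, Lemma 3.1.1 (arXiv p. 15, L60–62)]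
[cite: SilvermanAEC2009, Prop. III.8.1 (e_m alternating)] -/
theorem twin_tateLine_isotropic {P : Type} [AddCommGroup P] (hm : Rank1Residual.Mult W' 3) (hw : ((3 : ℕ) : 𝓞 K) ∈ w.asIdeal)
    (k : ℕ) (e : geomTorsion (W'.baseChange K) (((3 : ℕ) : ℤ) ^ k) →+ geomTorsion (W'.baseChange K) (((3 : ℕ) : ℤ) ^ k) →+ P)
    (hself : ∀ a, e a a = 0) :
    ∀ a ∈ (W'.baseChange K).torsionFilAt w (((3 : ℕ) : ℤ) ^ k), ∀ b ∈ (W'.baseChange K).torsionFilAt w (((3 : ℕ) : ℤ) ^ k),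
      e a b = 0 := by
  haveI : (W'.baseChange K).IsElliptic := by rw [WeierstrassCurve.baseChange]; infer_instance
  exact (W'.baseChange K).pairing_torsionFilAt_eq_zero_of_hasMultiplicativeReductionAt_three w hw
    (hasMultiplicativeReductionAt_baseChange_of_mult_three W' hm K w hw) k e hself

end Summit.BirchSwinnertonDyer.BirchSwinnertonDyer.Theorems.UniversalToricDescentTwinTateLineAtThree

end
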